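import Summits.ResolutionOfSingularities.ResolutionOfSingularities.Theorems.HilbertSamuelEliminationSigmaMaxModificationsCorridor3SigmaCyclePlusPackage
import Summits.ResolutionOfSingularities.ResolutionOfSingularities.Theorems.HilbertSamuelEliminationSigmaMaxModificationsCorridor3SigmaIsoRows
import HarnessLib

/-!
# [OURS · L1 W4.2] σ-LAYER — the CYCLE INVARIANT along Ω⁺-chains (`CycleInvPlus`) — brick 0 of the Ω-transports

Crux chain w42 (`SigmaMaxModifications`, stmt-ResolutionOfSingularities-18506; conjunct `SigmaMaxModificationsCorridor3`,
stmt-ResolutionOfSingularities-19249), res-L1-w42-plan-1 RULING v3.14-12 (BR-1)/(BR-6) (Ω⁺ Defs p523517 + Package p524329 landed; this is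
brick 0 of the Ω-transports (4)). Typer res-type-040 (gen 18). Port of `…WLadderStrataScope` §2 (`CycleInv`, p504439) to the END-rule variant
Ω⁺: the invariant along chains of `CanonicalNearStepσ (Strategy.ofStageOraclePlus ω)` (res-D-pv-047's σ-steps, p519751) from a maximal origin
with `ν ≠ Φ^{(N)}`, for an Ω⁺-ADMISSIBLE stage oracle (`OracleAdmissibleΩplus`), with the WEAK pending clause of
`isCanonicalStepΩplus_cycle_package` (replayed subscheme ⊆ stratum, label ≤ year, remaining centres regular, last stage regular). Every
`theorem` is PROVED. OURS (cell res-hironaka, slot W4.2); NOT statements of H. Hironaka's manuscript [Hironaka2017] nor of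
[CossartJannsenSaito2020]; AI-drafted, weaker than expert review. Helper file `--supports stmt-ResolutionOfSingularities-19249` (counted 0).

Contents: `CycleInvPlus k N ν s` (structure, `Prop`), `IsMaximalOrigin.exists_cycleInvPlus`, `CycleInvPlus.isNoetherian`, `CycleInvPlus.centre`
(regular · ⊆ `X_n(ν)` · permissible · `H^N` non-increase), `CycleInvPlus.step` / `.of_reaches`, `exists_cycleInvPlus_chain` (res-type-012's `reachesσ_chain`, `…Corridor3SigmaIsoRows`, reused).
References: CJS LNM 2270 Rem. 6.29 (1) p. 92, Thm. 3.3, Thm. 3.10 (1) [CossartJannsenSaito2020]; tree `…WLadderStrataScope` (p504439),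
`…Corridor3SigmaStepDefs` (p519751/p520618), `…Corridor3SigmaCyclePlusDefs` (p523517), `…Corridor3SigmaCyclePlusPackage` (p524329).
-/

noncomputable section

set_option linter.dupNamespace false

open CategoryTheory AlgebraicGeometry TopologicalSpace Topology
open Summit.ResolutionOfSingularities.ResolutionOfSingularities.Theorems.CampaignW42
open Literature.AlgebraicGeometry.Resolution Literature.RingTheory.HilbertSamuel
open Summit.ResolutionOfSingularities.ResolutionOfSingularities.Theorems.SigmaMaxModificationsCorridor3

namespace Summit.ResolutionOfSingularities.ResolutionOfSingularities.Theorems.SigmaMaxModificationsCorridor3.Sigma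

universe u

variable {ω : StageOracle.{u}} {N : ℕ} {ν : ℕ → ℕ}

/-- [OURS · L1 W4.2] **THE CYCLE INVARIANT OF AN Ω⁺-RUN AT A MARKED STAGE** (weak pending clause): finite type over `k`, reduced,
`dim ≤ N`, `ν` never exceeded, labels `≤` year, and inside a cycle the replayed subscheme lies IN the stratum (not necessarily equal to
the label part), its label is `≤` the year, the remaining centres are regular and the replayed last stage is regular. OURS bookkeeping;
NOT a statement of the manuscript. [cite: CossartJannsenSaito2020, Rem. 6.29 (1), p. 92] -/
structure CycleInvPlus (k : Type u) [Field k] (N : ℕ) (ν : ℕ → ℕ) (s : MarkedStage.{u}) : Prop where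
  /-- finite type over `k` -/
  overField : ∃ f : s.W ⟶ Spec (.of k), LocallyOfFiniteType f ∧ QuasiCompact f
  /-- reduced -/
  isReduced : IsReduced s.W
  /-- `dim ≤ N` -/
  dim_le : topologicalKrullDim s.W ≤ (N : WithBot ℕ∞)
  /-- `ν` is never exceeded -/
  supMax : ∀ w : s.W, ν ≤ Scheme.hsFun s.W N w → Scheme.hsFun s.W N w = ν
  /-- labels `≤` year -/
  label_le_year : ∀ Z, s.L.label Z ≤ s.L.year
  /-- inside a cycle: replayed subscheme inside the stratum, label `≤` year, remaining centres regular, last stage regular -/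
  pending : ∀ Q, s.P = some Q →
    Set.range Q.hom.base ⊆ Scheme.hsStratum s.W N ν ∧ Q.lbl ≤ s.L.year ∧ Q.rest.AllRegular ∧
      Literature.AlgebraicGeometry.Resolution.Scheme.IsRegular Q.rest.top

/-- **The invariant holds at the initial marked stage of a maximal origin.** [cite: CossartJannsenSaito2020, Rem. 6.29 (1)] -/
theorem _root_.Summit.ResolutionOfSingularities.ResolutionOfSingularities.Theorems.CampaignW42.IsMaximalOrigin.exists_cycleInvPlus
    {p : ℕ} {X : Scheme.{u}} [IsLocallyNoetherian X] {x : X} (hX : IsMaximalOrigin p N ν X x) :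
    ∃ (k : Type u) (_ : Field k), CycleInvPlus k N ν (MarkedStage.init X x) := by
  obtain ⟨k, _, _, f, -, hft, hqc⟩ := hX.exists_structure
  exact ⟨k, inferInstance,
    { overField := ⟨f, hft, hqc⟩
      isReduced := hX.isReduced
      dim_le := hX.dim_le
      supMax := fun w hw => le_antisymm (hX.maximal.2 ⟨w, rfl⟩ hw) hw
      label_le_year := fun _ => le_rfl
      pending := fun Q h => by cases h }⟩

namespace CycleInvPlus

variable {k : Type u} [Field k] {s s' : MarkedStage.{u}}

/-- A stage under the invariant is a Noetherian scheme. [folklore] -/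
theorem isNoetherian (h : CycleInvPlus k N ν s) : IsNoetherian s.W := by
  obtain ⟨f, hft, hqc⟩ := h.overField
  haveI := s.ln
  exact Scheme.isNoetherian_of_finiteType_over_field f

/-- **THE Ω⁺ CENTRE UNDER THE INVARIANT (admissible stage oracle, `ν ≠ Φ^{(N)}`)**: regular, inside `X_n(ν)`, PERMISSIBLE, and `H^N`
does not increase along its blow-up. [cite: CossartJannsenSaito2020, Rem. 6.29 (1), Thm. 3.3, Thm. 3.10 (1)] -/
theorem centre (hω : OracleAdmissibleΩplus ω) (hν : ν ≠ iterPSum N Phi) (h : CycleInvPlus k N ν s) {C : s.W.IdealSheafData}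
    {P' : Option (Pending (blowup C))} (hcs : IsCanonicalStepΩplus ω s.ln N ν s.L s.P C P') :
    Literature.AlgebraicGeometry.Resolution.Scheme.IsRegular C.subscheme ∧ (C.support : Set s.W) ⊆ Scheme.hsStratum s.W N ν ∧
      IdealSheafData.IsPermissible C ∧
      ∀ z : ↥(blowup C), Scheme.hsFun (blowup C) N z ≤ Scheme.hsFun s.W N ((blowup.π C).base z) := by
  obtain ⟨h1, h2, h3, h4, -⟩ :=
    isCanonicalStepΩplus_cycle_package (k := k) hω hν s.ln h.overField h.isReduced h.dim_le h.supMax h.label_le_year h.pending hcs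
  exact ⟨h1, h2, h3, h4⟩

/-- **THE INVARIANT PROPAGATES ALONG Ω⁺-STEPS** followed at the marked points. [cite: CossartJannsenSaito2020, Rem. 6.29 (1), p. 92] -/
theorem step (hω : OracleAdmissibleΩplus ω) (hν : ν ≠ iterPSum N Phi) (h : CycleInvPlus k N ν s)
    (hst : CanonicalNearStepσ (Strategy.ofStageOraclePlus ω) N ν s s') : CycleInvPlus k N ν s' := by
  obtain ⟨C, P', hln, x', hcs, -, -, -, rfl⟩ := hst
  obtain ⟨-, -, -, -, hk', hred', hdim', hsup', hlab', hpend'⟩ :=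
    isCanonicalStepΩplus_cycle_package (k := k) hω hν s.ln h.overField h.isReduced h.dim_le h.supMax h.label_le_year h.pending hcs
  exact ⟨hk', hred', hdim', hsup', hlab', hpend'⟩

/-- … and along `Reachesσ`. [folklore] -/
theorem of_reaches (hω : OracleAdmissibleΩplus ω) (hν : ν ≠ iterPSum N Phi) (h : CycleInvPlus k N ν s)
    (hr : Reachesσ (Strategy.ofStageOraclePlus ω) N ν s s') : CycleInvPlus k N ν s' := by
  induction hr with
  | refl => exact h
  | tail _ hlast ih => exact ih.step hω hν hlast

end CycleInvPlus

/-- **Along an Ω⁺-chain from a maximal origin with `ν ≠ Φ^{(N)}` every stage is under the invariant.** [cite: CossartJannsenSaito2020, Rem. 6.29 (1)] -/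
theorem exists_cycleInvPlus_chain {p : ℕ} (hω : OracleAdmissibleΩplus ω) (hν : ν ≠ iterPSum N Phi) {X : Scheme.{u}}
    [IsLocallyNoetherian X] {x : X} (hX : IsMaximalOrigin p N ν X x) {c : ℕ → MarkedStage.{u}}
    (h0 : Reachesσ (Strategy.ofStageOraclePlus ω) N ν (MarkedStage.init X x) (c 0))
    (hstep : ∀ n, CanonicalNearStepσ (Strategy.ofStageOraclePlus ω) N ν (c n) (c (n + 1))) :
    ∃ (k : Type u) (_ : Field k), ∀ n, CycleInvPlus k N ν (c n) := by
  obtain ⟨k, _, hinit⟩ := hX.exists_cycleInvPlus (N := N) (ν := ν)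
  exact ⟨k, inferInstance, fun n => hinit.of_reaches hω hν (reachesσ_chain h0 hstep n)⟩

end Summit.ResolutionOfSingularities.ResolutionOfSingularities.Theorems.SigmaMaxModificationsCorridor3.Sigma

end
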